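import Literature.AlgebraicGeometry.Modules.AffineLocalizing
import Mathlib.AlgebraicGeometry.Morphisms.QuasiSeparated
import HarnessLib

/-!
# The push-forward of the structure sheaf along a qcqs morphism is affine-localizing

For a quasi-compact quasi-separated morphism of schemes `g : Y → X`, the sheaf of `𝒪_X`-modules
`g_* 𝒪_Y` (Mathlib `Scheme.Modules.pushforward g` of `SheafOfModules.unit`) is affine-localizing
(`Literature/AlgebraicGeometry/Modules/AffineLocalizing`): for an affine open `V ⊆ X` and
`r ∈ Γ(V, 𝒪_X)`, `Γ(D(r), g_*𝒪_Y) = Γ(g⁻¹D(r), 𝒪_Y) = Γ(Y_{g^*r} ∩ g⁻¹V, 𝒪_Y)` is the localization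
`Γ(g⁻¹V, 𝒪_Y)_{g^* r}` because `g⁻¹V` is quasi-compact and quasi-separated — the "qcqs lemma"
(Hartshorne II Ex. 2.16; The Stacks Project, Tag 01P7; Mathlib
`exists_eq_pow_mul_of_isCompact_of_isQuasiSeparated`,
`exists_pow_mul_eq_zero_of_res_basicOpen_eq_zero_of_isCompact`). This is the quasi-coherence of
`g_*𝒪_Y` for qcqs `g` (Hartshorne II Prop. 5.8 (c); Stacks 01LC) in the affine-local form used by the
Čech dévissage (the sheaf `π_*𝒪_{X'}` of a Chow cover `π`).

* `IsAffineLocalizing.pushforward_unit` — the theorem.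

Everything is proved; no named facts. Mathlib searched (pin v4.32): `Scheme.Hom.isCompact_preimage`,
`Scheme.Hom.isQuasiSeparated_preimage`, `Scheme.preimage_basicOpen`,
`exists_eq_pow_mul_of_isCompact_of_isQuasiSeparated`,
`exists_pow_mul_eq_zero_of_res_basicOpen_eq_zero_of_isCompact`, `Scheme.Modules.pushforward_obj_presheaf_map`
(used).

## References

* R. Hartshorne, *Algebraic Geometry*, GTM 52 (1977): II Ex. 2.16 (p. 81), II Prop. 5.8 (c) (p. 115).
  [Hartshorne1977]
* The Stacks Project, Tags 01P7, 01LC. [StacksProject]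
-/

noncomputable section

open CategoryTheory AlgebraicGeometry TopologicalSpace Opposite

universe u

namespace Literature.AlgebraicGeometry.Modules

variable {X Y : Scheme.{u}} (g : Y ⟶ X)

/-- The scalar action on `Γ(V, g_*𝒪_Y) = Γ(g⁻¹V, 𝒪_Y)`: `t • s = g^*(t) · s`. [folklore] -/
theorem pushforward_unit_smul (V : X.Opens) (t : Γ(X, V))
    (s : Γ((Scheme.Modules.pushforward g).obj (SheafOfModules.unit Y.ringCatSheaf), V)) :
    t • s = @HMul.hMul Γ(Y, g ⁻¹ᵁ V) Γ(Y, g ⁻¹ᵁ V) Γ(Y, g ⁻¹ᵁ V) instHMul (g.app V t) s := rfl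

/-- **`g_*𝒪_Y` is affine-localizing for `g` quasi-compact and quasi-separated** (the qcqs lemma,
Hartshorne II Ex. 2.16 / Prop. 5.8 (c)). [cite: Hartshorne1977, II Prop. 5.8 (c) (p. 115) with Ex. 2.16 (p. 81)] -/
theorem IsAffineLocalizing.pushforward_unit [QuasiCompact g] [QuasiSeparated g] :
    IsAffineLocalizing ((Scheme.Modules.pushforward g).obj (SheafOfModules.unit Y.ringCatSheaf)) := by
  constructor
  · intro V hV r W hW s
    have hι : W ≤ V := hW.le.trans (X.basicOpen_le r)
    have hqc : IsCompact (g ⁻¹ᵁ V : Set Y) := g.isCompact_preimage hV.isCompact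
    have hqs : IsQuasiSeparated (g ⁻¹ᵁ V : Set Y) := g.isQuasiSeparated_preimage hV.isQuasiSeparated
    have eW : g ⁻¹ᵁ W = Y.basicOpen (g.app V r) := by rw [hW, Scheme.preimage_basicOpen]
    -- the section `s`, read in `Γ(Y, Y_{g^* r})`
    obtain ⟨n, y, hy⟩ := exists_eq_pow_mul_of_isCompact_of_isQuasiSeparated Y (g ⁻¹ᵁ V) hqc hqs
      (g.app V r) (Y.presheaf.map (homOfLE eW.ge).op (s : Γ(Y, g ⁻¹ᵁ W)))
    refine ⟨n, y, ?_⟩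
    dsimp only [TopCat.Presheaf.restrictOpen, TopCat.Presheaf.restrict] at hy
    -- transport `hy` back to `g⁻¹W`
    have key := congrArg (Y.presheaf.map (homOfLE eW.le).op) hy
    rw [map_mul, map_pow, ringMap_map, ringMap_map, ringMap_map, ringMap_self] at key
    change Y.presheaf.map ((Opens.map g.base).map (homOfLE hι)).op y =
      @HMul.hMul Γ(Y, g ⁻¹ᵁ W) Γ(Y, g ⁻¹ᵁ W) Γ(Y, g ⁻¹ᵁ W) instHMul
        (g.app W (X.presheaf.map (homOfLE hι).op r ^ n)) s
    rw [map_pow, show g.app W (X.presheaf.map (homOfLE hι).op r) =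
        Y.presheaf.map ((Opens.map g.base).map (homOfLE hι)).op (g.app V r) from
      ConcreteCategory.congr_hom (g.naturality (homOfLE hι).op) r]
    refine (congrArg (fun φ => Y.presheaf.map φ y) (Subsingleton.elim _ _)).trans (key.trans ?_)
    exact congrArg (fun φ => @HMul.hMul Γ(Y, g ⁻¹ᵁ W) Γ(Y, g ⁻¹ᵁ W) Γ(Y, g ⁻¹ᵁ W) instHMul
      (Y.presheaf.map φ (g.app V r) ^ n) s) (Subsingleton.elim _ _)
  · intro V hV r x W hWV hrW hx
    have hqc : IsCompact (g ⁻¹ᵁ V : Set Y) := g.isCompact_preimage hV.isCompact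
    have hD : Y.basicOpen (g.app V r) ≤ g ⁻¹ᵁ W := by
      rw [← Scheme.preimage_basicOpen]; exact g.preimage_mono hrW
    have hx' : Y.presheaf.map ((Opens.map g.base).map (homOfLE hWV)).op (x : Γ(Y, g ⁻¹ᵁ V)) = 0 := hx
    have h2 := congrArg (Y.presheaf.map (homOfLE hD).op) hx'
    rw [map_zero, ringMap_map] at h2
    obtain ⟨n, hn⟩ := exists_pow_mul_eq_zero_of_res_basicOpen_eq_zero_of_isCompact Y hqc
      (x : Γ(Y, g ⁻¹ᵁ V)) (g.app V r)
      ((congrArg (fun φ => Y.presheaf.map φ (x : Γ(Y, g ⁻¹ᵁ V))) (Subsingleton.elim _ _)).trans h2)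
    refine ⟨n, ?_⟩
    rw [pushforward_unit_smul, map_pow]
    exact hn

end Literature.AlgebraicGeometry.Modules

end
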